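import Mathlib
import HarnessLib
import Summits.Ventures.LatticeQCDFlow.Exactness.NCMCGeneralSpaceMarkovErgodic

/-!
# The ergodicity criterion for stationary Markov chains is an equivalence

HONEST FRAMING: exact (Metropolis-corrected) sampling algorithms for lattice gauge theory;
figures of merit are autocorrelation/cost numbers at stated couplings and volumes; no
continuum-physics claim.

Venture `LatticeQCDFlow` (cell pub-lqcd), topic `Exactness`; FANOUT row 13 (`eng-snf`, GEN-16).
NEW WORK of the cell, not a published result; no definition is introduced; nothing is cited as a
fact.  `NCMCGeneralSpaceMarkovErgodic.ergodic_shift_chain` proved: no non-trivial almost invariant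
set ⇒ `P_{π,κ}` is shift-ergodic.  This file proves the (easy) converse and records the
equivalence, so that the criterion is known to be sharp: a level sampler with a non-trivial almost
invariant set (a frozen topological sector, say) gives a NON-ergodic restart chain, on which time
averages converge to the wrong, sector-conditional, values.

## Content (`κ` Markov on `S`, `π` an invariant probability law, `θ` the shift)

* `chain_measureReal_symmDiff_eval` — for a measurable `B ⊆ S` that is almost invariant under `π`,
  the path events `{x_0 ∈ B}` and `{x_1 ∈ B} = θ⁻¹{x_0 ∈ B}` differ by a `P_π`-null set.
* **`ae_invariant_trivial_of_ergodic`** — if `P_{π,κ}` is shift-ergodic, every almost invariant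
  measurable set is `π`-trivial (Mathlib's `QuasiErgodic.ae_empty_or_univ₀` on `{x_0 ∈ B}`).
* **`ergodic_shift_chain_iff`** — THE EQUIVALENCE: `P_{π,κ}` is ergodic for the shift iff every
  measurable set almost invariant for `κ` under `π` has `π`-measure `0` or `1`.

NOT CLAIMED: anything quantitative.
-/

namespace Summit.Ventures.LatticeQCDFlow.Exactness.GeneralNCMC

open MeasureTheory ProbabilityTheory Set Filter Finset Preorder
open scoped ENNReal Topology

variable {S : Type*} [MeasurableSpace S] (κ : Kernel S S) [IsMarkovKernel κ]
variable {π : Measure S} [IsProbabilityMeasure π]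

/-- For an almost invariant `B`, the events `{x_0 ∈ B}` and `{x_1 ∈ B}` agree `P_π`-almost surely. -/
theorem ae_eval_zero_mem_iff_eval_one_mem (hπ : Kernel.Invariant κ π) {B : Set S}
    (hB : MeasurableSet B) (hout : ∀ᵐ z ∂π, z ∈ B → κ z Bᶜ = 0)
    (hin : ∀ᵐ z ∂π, z ∉ B → κ z B = 0) :
    ∀ᵐ x ∂(Kernel.trajMeasure (X := fun _ : ℕ => S) π
        (fun n : ℕ => κ.comap (fun h : (j : ↥(Finset.Iic n)) → S => h ⟨n, Finset.mem_Iic.2 le_rfl⟩)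
          (measurable_pi_apply _))), x 0 ∈ B ↔ x 1 ∈ B := by
  set P := Kernel.trajMeasure (X := fun _ : ℕ => S) π
    (fun n : ℕ => κ.comap (fun h : (j : ↥(Finset.Iic n)) → S => h ⟨n, Finset.mem_Iic.2 le_rfl⟩)
      (measurable_pi_apply _)) with hP
  -- the two one-sided differences are null
  have h01 : P ({x | x 0 ∈ B} ∩ {x | x 1 ∈ Bᶜ}) = 0 := by
    have hr : P.real ({x | x 0 ∈ B} ∩ {x | x 1 ∈ Bᶜ}) = 0 := by
      rw [hP, chain_measureReal_eval_zero_one κ hπ hB hB.compl,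
        setIntegral_congr_ae (g := fun _ => (0 : ℝ)) hB ?_, integral_zero]
      filter_upwards [hout] with z hz hzB
      rw [measureReal_def, hz hzB, ENNReal.toReal_zero]
    exact (measureReal_eq_zero_iff (measure_ne_top _ _)).1 hr
  have h10 : P ({x | x 0 ∈ Bᶜ} ∩ {x | x 1 ∈ B}) = 0 := by
    have hr : P.real ({x | x 0 ∈ Bᶜ} ∩ {x | x 1 ∈ B}) = 0 := by
      rw [hP, chain_measureReal_eval_zero_one κ hπ hB.compl hB,
        setIntegral_congr_ae (g := fun _ => (0 : ℝ)) hB.compl ?_, integral_zero]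
      filter_upwards [hin] with z hz hzB
      rw [measureReal_def, hz hzB, ENNReal.toReal_zero]
    exact (measureReal_eq_zero_iff (measure_ne_top _ _)).1 hr
  have a01 := measure_eq_zero_iff_ae_notMem.1 h01
  have a10 := measure_eq_zero_iff_ae_notMem.1 h10
  filter_upwards [a01, a10] with x hx01 hx10
  constructor
  · intro h0
    by_contra h1
    exact hx01 ⟨h0, h1⟩
  · intro h1
    by_contra h0
    exact hx10 ⟨h0, h1⟩

/-- **The converse of the criterion**: if `P_{π,κ}` is shift-ergodic, every measurable set almost
invariant for `κ` under `π` is `π`-trivial. -/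
theorem ae_invariant_trivial_of_ergodic (hπ : Kernel.Invariant κ π)
    (hErg : Ergodic (fun (x : ℕ → S) (k : ℕ) => x (k + 1))
      (Kernel.trajMeasure (X := fun _ : ℕ => S) π
        (fun n : ℕ => κ.comap (fun h : (j : ↥(Finset.Iic n)) → S => h ⟨n, Finset.mem_Iic.2 le_rfl⟩)
          (measurable_pi_apply _))))
    (B : Set S) (hB : MeasurableSet B) (hout : ∀ᵐ z ∂π, z ∈ B → κ z Bᶜ = 0)
    (hin : ∀ᵐ z ∂π, z ∉ B → κ z B = 0) : π B = 0 ∨ π B = 1 := by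
  set P := Kernel.trajMeasure (X := fun _ : ℕ => S) π
    (fun n : ℕ => κ.comap (fun h : (j : ↥(Finset.Iic n)) → S => h ⟨n, Finset.mem_Iic.2 le_rfl⟩)
      (measurable_pi_apply _)) with hP
  have hA : MeasurableSet {x : ℕ → S | x 0 ∈ B} := measurable_pi_apply 0 hB
  -- `θ⁻¹ {x_0 ∈ B} = {x_1 ∈ B}` agrees with `{x_0 ∈ B}` almost surely
  have hAE : (fun (x : ℕ → S) (k : ℕ) => x (k + 1)) ⁻¹' {x : ℕ → S | x 0 ∈ B} =ᵐ[P]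
      ({x : ℕ → S | x 0 ∈ B} : Set (ℕ → S)) := by
    have h := ae_eval_zero_mem_iff_eval_one_mem κ hπ hB hout hin
    rw [← hP] at h
    filter_upwards [h] with x hx
    exact propext hx.symm
  have hPA : P {x : ℕ → S | x 0 ∈ B} = π B := by
    rw [show ({x : ℕ → S | x 0 ∈ B} : Set (ℕ → S)) = (fun x : ℕ → S => x 0) ⁻¹' B from rfl,
      ← Measure.map_apply (measurable_pi_apply 0) hB, hP, chain_map_eval_of_invariant κ hπ 0]
  rcases hErg.quasiErgodic.ae_empty_or_univ₀ hA.nullMeasurableSet hAE with h0 | h1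
  · left
    rw [← hPA, measure_congr h0, measure_empty]
  · right
    rw [← hPA, measure_congr h1, measure_univ]

/-- **THE EQUIVALENCE.**  For a Markov kernel `κ` with invariant probability law `π`: the chain law
`P_{π,κ}` is ergodic for the shift if and only if every measurable set that is almost invariant for
`κ` under `π` (`κ(z, Bᶜ) = 0` for a.e. `z ∈ B`, `κ(z, B) = 0` for a.e. `z ∉ B`) is `π`-trivial. -/
theorem ergodic_shift_chain_iff (hπ : Kernel.Invariant κ π) :
    Ergodic (fun (x : ℕ → S) (k : ℕ) => x (k + 1))
      (Kernel.trajMeasure (X := fun _ : ℕ => S) π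
        (fun n : ℕ => κ.comap (fun h : (j : ↥(Finset.Iic n)) → S => h ⟨n, Finset.mem_Iic.2 le_rfl⟩)
          (measurable_pi_apply _))) ↔
    ∀ B : Set S, MeasurableSet B → (∀ᵐ z ∂π, z ∈ B → κ z Bᶜ = 0) →
      (∀ᵐ z ∂π, z ∉ B → κ z B = 0) → π B = 0 ∨ π B = 1 :=
  ⟨fun hErg B hB hout hin => ae_invariant_trivial_of_ergodic κ hπ hErg B hB hout hin,
    ergodic_shift_chain κ hπ⟩

end Summit.Ventures.LatticeQCDFlow.Exactness.GeneralNCMC
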